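import Summits.CriticalPhenomena.PercolationContinuityZ3.Theorems.PercNearOneGluingNoHeavyLowerTailKnQuestion8CoefficientwiseCoreClassKernelMixPathTransfer
import HarnessLib

/-!
# The fibre injection lemma: the increasing-event transfer on a path fibre with the FULL partner set

Support file (`--supports stmt-CriticalPhenomena-4575`, closed), prover `prim-cplus-coupling` (gen 39).  No definitions, no notations, no named facts,
no sorries; standard axioms.  Memo `prim-cplus-coupling/A5-COUPLING-gen39.md` §2.

Context.  CONJECTURE IET (gen 37 memo §2, §4): for a graph `E`, root `u`, observer `b` and EVERY up-closed event `𝒱`,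
`Σ_{ω ∈ 𝒱 : b ∈ X∖Y} h(X)k(X) + Σ_{ω ∈ 𝒱 : b ∈ Y∖X} (hᵃX − hᵇY)(kᵃX − kᵇY) ≥ 0` (`X = C_u ω` red cluster, `Y = C_u(E∖ω)` blue cluster, monotone levels
`0 ≤ hᵃ, hᵇ ≤ h`, `0 ≤ kᵃ, kᵇ ≤ k`).  Gen 39 settles it for CYCLES through `u, b` (memo §3) by splitting the demand along the two arcs and proving two FIBRE LEMMAS
for the fibre `{W blue} × 2^A` (`W, A` the two arcs).  When both arcs carry demand, `𝒱` contains every colouring in which one arc is red, and each fibre may draw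
on its FULL partner set `{(W red, ζ) : ζ ∉ {∅, A}}`; the inequality that is then needed is the FIBRE INJECTION LEMMA (memo §2.2, 'PF″'; gen 37's CONJECTURE PF′,
which kept only the partners `η ∪ W`, `η ∈ F`, is FALSE — memo §1).  This file proves its ABSTRACT form, in which the cycle enters only through three maps:
* `Coefficientwise.fibre_pointwise_base`, `Coefficientwise.fibre_pointwise` — the pointwise 'regime split' of the anti-term `(a − p)(c − q)` at the values
  `α₀ = hᵃ{u}`, `γ₀ = kᵃ{u}`: it is bounded below by minus [an `α₀`-budget and a `γ₀`-budget of the COMPLEMENT partner] minus [the `++`-budget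
  `(h − α₀)(k − γ₀)` of a COVERING partner];
* `Coefficientwise.fibre_sum_le_sum_of_injOn` — reindexing along an injection into nonnegative weights;
* `Coefficientwise.fibreInjection_transfer` — **THE FIBRE INJECTION LEMMA**: on a cube `2^Q` with demand family `F ∌ ∅`, set maps `X, Y, G` with
  `X₀ ⊆ X(η)`, `X₀ ⊆ G(ζ)`, `Y(η) ⊆ G(Q ∖ η)`, and an injection `σ` on `{η ∈ F ∖ {Q} : X(η) ≠ X₀}` into `2^Q ∖ {∅, Q}` with `X(η) ∪ Y(η) ⊆ G(σ η)`:
  `0 ≤ Σ_{η ∈ F∖{Q}} (hᵃXη − hᵇYη)(kᵃXη − kᵇYη) + Σ_{ζ ⊆ Q, ζ ∉ {∅,Q}} h(Gζ)k(Gζ)`.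
  For the cycle: `Q = A`, `X(η) = C_u η`, `Y(η) = C_u(E∖η)`, `G(ζ) = C_u(ζ ∪ W) ∪ C_b(ζ ∪ W)`, `X₀ = {u}`, and `σ(η)` = keep the red run at `u` and the blue edge
  after it, complement the rest of the arc (memo §2.2); the complement partner is the classical colour swap, `σ` a partial one.
[cite: KozmaNitzan2024, Questions 8–9 (§5.5 p. 36) (context: the Question-8 pocket covariance programme)]
-/

namespace Summit.CriticalPhenomena.PercolationContinuityZ3.Theorems

open Finset Literature.Probability.Percolation

namespace Coefficientwise

variable {ι V : Type*}

/-- Regime split of the anti-term at a demand point whose red cluster is the base point (`a = α₀`, `c = γ₀`): for `0 ≤ p ≤ Hc`, `0 ≤ q ≤ Kc`,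
`0 ≤ α₀ ≤ Hc`, `0 ≤ γ₀ ≤ Kc`:  `(α₀ − p)(γ₀ − q) ≥ −(α₀(Kc − γ₀) + γ₀(Hc − α₀))` (the two cross regimes are paid by the complement partner's budgets).
[cite: KozmaNitzan2024, §5.5 (context only; elementary)] -/
theorem fibre_pointwise_base {α₀ γ₀ p q Hc Kc : ℝ} (hα : 0 ≤ α₀) (hγ : 0 ≤ γ₀) (hp0 : 0 ≤ p) (hpH : p ≤ Hc) (hαH : α₀ ≤ Hc)
    (hq0 : 0 ≤ q) (hqK : q ≤ Kc) (hγK : γ₀ ≤ Kc) :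
    -(α₀ * (Kc - γ₀) + γ₀ * (Hc - α₀)) ≤ (α₀ - p) * (γ₀ - q) := by
  rcases le_or_gt p α₀ with hp | hp <;> rcases le_or_gt q γ₀ with hq | hq
  · nlinarith [mul_nonneg (sub_nonneg.mpr hp) (sub_nonneg.mpr hq), mul_nonneg hα (sub_nonneg.mpr hγK), mul_nonneg hγ (sub_nonneg.mpr hαH)]
  · nlinarith [mul_nonneg (sub_nonneg.mpr hp) (sub_nonneg.mpr hqK), mul_nonneg hp0 (sub_nonneg.mpr hq.le), mul_nonneg hγ (sub_nonneg.mpr hαH)]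
  · nlinarith [mul_nonneg (sub_nonneg.mpr hq) (sub_nonneg.mpr hpH), mul_nonneg hq0 (sub_nonneg.mpr hp.le), mul_nonneg hα (sub_nonneg.mpr hγK)]
  · nlinarith [mul_nonneg (sub_nonneg.mpr hp.le) (sub_nonneg.mpr hq.le), mul_nonneg hα (sub_nonneg.mpr hγK), mul_nonneg hγ (sub_nonneg.mpr hαH)]

/-- Regime split of the anti-term at a general demand point: `α₀ ≤ a ≤ Hs`, `0 ≤ p ≤ min(Hc, Hs)`, `γ₀ ≤ c ≤ Ks`, `0 ≤ q ≤ min(Kc, Ks)`, `0 ≤ α₀ ≤ Hc`,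
`0 ≤ γ₀ ≤ Kc` give `(a − p)(c − q) ≥ −(α₀(Kc − γ₀) + γ₀(Hc − α₀) + (Hs − α₀)(Ks − γ₀))`: writing `a = α₀ + a₂`, `p = min(p, α₀) + (p − α₀)⁺` etc., the
four products are `≥ 0`, `≥ −α₀(q − γ₀)⁺`, `≥ −γ₀(p − α₀)⁺`, `≥ −(Hs − α₀)(Ks − γ₀)` (`Hc, Kc` = levels of the complement partner, `Hs, Ks` of the covering one).
[cite: KozmaNitzan2024, §5.5 (context only; elementary)] -/
theorem fibre_pointwise {α₀ γ₀ a p c q Hc Kc Hs Ks : ℝ} (hα : 0 ≤ α₀) (hγ : 0 ≤ γ₀)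
    (hαa : α₀ ≤ a) (haH : a ≤ Hs) (hp0 : 0 ≤ p) (hpHc : p ≤ Hc) (hpHs : p ≤ Hs) (hαHc : α₀ ≤ Hc)
    (hγc : γ₀ ≤ c) (hcK : c ≤ Ks) (hq0 : 0 ≤ q) (hqKc : q ≤ Kc) (hqKs : q ≤ Ks) (hγKc : γ₀ ≤ Kc) :
    -(α₀ * (Kc - γ₀) + γ₀ * (Hc - α₀) + (Hs - α₀) * (Ks - γ₀)) ≤ (a - p) * (c - q) := by
  have hαHs : α₀ ≤ Hs := le_trans hαa haH
  have hγKs : γ₀ ≤ Ks := le_trans hγc hcK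
  rcases le_or_gt p α₀ with hp | hp <;> rcases le_or_gt q γ₀ with hq | hq
  · -- all four regime products nonnegative
    nlinarith [mul_nonneg (sub_nonneg.mpr (le_trans hp hαa)) (sub_nonneg.mpr (le_trans hq hγc)), mul_nonneg hα (sub_nonneg.mpr hγKc),
      mul_nonneg hγ (sub_nonneg.mpr hαHc), mul_nonneg (sub_nonneg.mpr hαHs) (sub_nonneg.mpr hγKs)]
  · -- p ≤ α₀ < .., q > γ₀ : (a−p)(c−q) = (a−p)(c−γ₀) − (a−p)(q−γ₀)
    nlinarith [mul_nonneg (sub_nonneg.mpr (le_trans hp hαa)) (sub_nonneg.mpr hγc), mul_nonneg hα (sub_nonneg.mpr hqKc),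
      mul_nonneg hp0 (sub_nonneg.mpr hq.le), mul_nonneg (sub_nonneg.mpr haH) (sub_nonneg.mpr hγKs),
      mul_nonneg (sub_nonneg.mpr hαa) (sub_nonneg.mpr hqKs), mul_nonneg hγ (sub_nonneg.mpr hαHc)]
  · -- p > α₀, q ≤ γ₀
    nlinarith [mul_nonneg (sub_nonneg.mpr hαa) (sub_nonneg.mpr hq), mul_nonneg hq0 (sub_nonneg.mpr hp.le),
      mul_nonneg hγ (sub_nonneg.mpr hpHc), mul_nonneg (sub_nonneg.mpr hpHs) (sub_nonneg.mpr hγKs),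
      mul_nonneg (sub_nonneg.mpr hp.le) (sub_nonneg.mpr hcK), mul_nonneg (sub_nonneg.mpr hαa) (sub_nonneg.mpr hγc),
      mul_nonneg hα (sub_nonneg.mpr hγKc)]
  · -- p > α₀, q > γ₀ : only the `++` budget is needed
    rcases le_or_gt p a with hpa | hpa <;> rcases le_or_gt q c with hqc | hqc
    · nlinarith [mul_nonneg (sub_nonneg.mpr hpa) (sub_nonneg.mpr hqc), mul_nonneg hα (sub_nonneg.mpr hγKc), mul_nonneg hγ (sub_nonneg.mpr hαHc),
        mul_nonneg (sub_nonneg.mpr hαHs) (sub_nonneg.mpr hγKs)]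
    · nlinarith [mul_nonneg (sub_nonneg.mpr hpa) (sub_nonneg.mpr (le_trans hγc hcK)), mul_nonneg hα (sub_nonneg.mpr hγKc), mul_nonneg hγ (sub_nonneg.mpr hαHc),
        mul_nonneg (sub_nonneg.mpr (show a - p ≤ Hs - α₀ by linarith)) (sub_nonneg.mpr hγKs),
        mul_nonneg (sub_nonneg.mpr hpa) (sub_nonneg.mpr (show q - c ≤ Ks - γ₀ by linarith)),
        mul_nonneg (sub_nonneg.mpr hp.le) (sub_nonneg.mpr hqc.le)]
    · nlinarith [mul_nonneg (sub_nonneg.mpr hqc) (sub_nonneg.mpr (le_trans hαa haH)), mul_nonneg hα (sub_nonneg.mpr hγKc), mul_nonneg hγ (sub_nonneg.mpr hαHc),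
        mul_nonneg (sub_nonneg.mpr (show p - a ≤ Hs - α₀ by linarith)) (sub_nonneg.mpr hγKs),
        mul_nonneg (sub_nonneg.mpr hqc) (sub_nonneg.mpr (show c - γ₀ ≤ Ks - γ₀ by linarith)),
        mul_nonneg (sub_nonneg.mpr hpa.le) (sub_nonneg.mpr (show Ks - γ₀ - (c - q) ≥ 0 by linarith)),
        mul_nonneg (sub_nonneg.mpr hq.le) (sub_nonneg.mpr hp.le)]
    · nlinarith [mul_nonneg (sub_nonneg.mpr hpa.le) (sub_nonneg.mpr hqc.le), mul_nonneg hα (sub_nonneg.mpr hγKc), mul_nonneg hγ (sub_nonneg.mpr hαHc),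
        mul_nonneg (sub_nonneg.mpr hαHs) (sub_nonneg.mpr hγKs)]

/-- Reindexing along an injection into nonnegative weights: if `e` is injective on `s`, maps `s` into `t`, and `g ≥ 0` on `t`, then
`Σ_{a ∈ s} g(e a) ≤ Σ_{b ∈ t} g b`. [cite: KozmaNitzan2024, §5.5 (context only; folklore)] -/
theorem fibre_sum_le_sum_of_injOn {κ μ : Type*} [DecidableEq μ] {s : Finset κ} {t : Finset μ}
    (e : κ → μ) (he : Set.InjOn e s) (hst : ∀ a ∈ s, e a ∈ t) (g : μ → ℝ) (hg : ∀ b ∈ t, 0 ≤ g b) :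
    ∑ a ∈ s, g (e a) ≤ ∑ b ∈ t, g b := by
  rw [← Finset.sum_image (f := g) he]
  exact Finset.sum_le_sum_of_subset_of_nonneg (Finset.image_subset_iff.2 hst) fun b hb _ => hg b hb

open Classical in
/-- **THE FIBRE INJECTION LEMMA** (abstract form of memo §2.2, 'PF″').  Data: a finite coordinate set `Q`, a demand family `F` of subsets of `Q` not containing
`∅`; set maps `X, Y, G` (red cluster, blue cluster, partner set) and a base set `X₀` with `X₀ ⊆ X η` (`η ∈ F`) and `X₀ ⊆ G ζ` (`ζ ⊆ Q`); the COMPLEMENT partner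
covers the blue cluster, `Y η ⊆ G(Q ∖ η)`; and a map `σ` which on `{η ∈ F : η ≠ Q, X η ≠ X₀}` is injective, takes values in `2^Q ∖ {∅, Q}`, and COVERS:
`X η ∪ Y η ⊆ G(σ η)`.  Then for all monotone `h, k` and monotone levels `0 ≤ hᵃ, hᵇ ≤ h`, `0 ≤ kᵃ, kᵇ ≤ k`:
`0 ≤ Σ_{η ∈ F∖{Q}} (hᵃ(Xη) − hᵇ(Yη))(kᵃ(Xη) − kᵇ(Yη)) + Σ_{ζ ⊆ Q, ζ ∉ {∅, Q}} h(Gζ)k(Gζ)`.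
Proof: split each partner's supply `hk = α₀γ₀ + α₀(k−γ₀) + γ₀(h−α₀) + (h−α₀)(k−γ₀)` (`α₀ = hᵃX₀`, `γ₀ = kᵃX₀`); by `fibre_pointwise` a demand point costs at
most the two middle budgets of its complement partner plus the last budget of `σ η`; both assignments are injective (`fibre_sum_le_sum_of_injOn`).
[cite: KozmaNitzan2024, Questions 8–9 (§5.5 p. 36) (context)] -/
theorem fibreInjection_transfer [DecidableEq ι] (Q : Finset ι) (F : Finset (Finset ι)) (hFQ : ∀ η ∈ F, η ⊆ Q) (hF0 : ∅ ∉ F)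
    (X Y G : Finset ι → Set V) (X₀ : Set V)
    (hX0X : ∀ η ∈ F, X₀ ⊆ X η) (hX0G : ∀ ζ, ζ ⊆ Q → X₀ ⊆ G ζ)
    (hYc : ∀ η ∈ F, Y η ⊆ G (Q \ η))
    (σ : Finset ι → Finset ι)
    (hσQ : ∀ η ∈ F, η ≠ Q → X η ≠ X₀ → σ η ⊆ Q ∧ σ η ≠ ∅ ∧ σ η ≠ Q)
    (hσinj : ∀ η₁ ∈ F, ∀ η₂ ∈ F, η₁ ≠ Q → X η₁ ≠ X₀ → η₂ ≠ Q → X η₂ ≠ X₀ → σ η₁ = σ η₂ → η₁ = η₂)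
    (hσX : ∀ η ∈ F, η ≠ Q → X η ≠ X₀ → X η ⊆ G (σ η))
    (hσY : ∀ η ∈ F, η ≠ Q → X η ≠ X₀ → Y η ⊆ G (σ η))
    (h k ha hb ka kb : Set V → ℝ)
    (hh : Monotone h) (hk : Monotone k) (mha : Monotone ha) (mhb : Monotone hb) (mka : Monotone ka) (mkb : Monotone kb)
    (ha0 : ∀ S, 0 ≤ ha S) (hah : ∀ S, ha S ≤ h S) (hb0 : ∀ S, 0 ≤ hb S) (hbh : ∀ S, hb S ≤ h S)
    (ka0 : ∀ S, 0 ≤ ka S) (kak : ∀ S, ka S ≤ k S) (kb0 : ∀ S, 0 ≤ kb S) (kbk : ∀ S, kb S ≤ k S) :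
    0 ≤ (∑ η ∈ F.erase Q, (ha (X η) - hb (Y η)) * (ka (X η) - kb (Y η)))
      + ∑ ζ ∈ (Q.powerset.erase ∅).erase Q, h (G ζ) * k (G ζ) := by
  set α₀ : ℝ := ha X₀ with hα₀
  set γ₀ : ℝ := ka X₀ with hγ₀
  set Tgt : Finset (Finset ι) := (Q.powerset.erase ∅).erase Q with hTgt
  set D : Finset (Finset ι) := F.erase Q with hD
  set D' : Finset (Finset ι) := D.filter (fun η => X η ≠ X₀) with hD'
  set f₁ : Finset ι → ℝ := fun ζ => α₀ * (k (G ζ) - γ₀) + γ₀ * (h (G ζ) - α₀) with hf₁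
  set f₂ : Finset ι → ℝ := fun ζ => (h (G ζ) - α₀) * (k (G ζ) - γ₀) with hf₂
  have hα : 0 ≤ α₀ := ha0 X₀
  have hγ : 0 ≤ γ₀ := ka0 X₀
  -- levels of partners dominate the base values
  have hαG : ∀ ζ, ζ ⊆ Q → α₀ ≤ h (G ζ) := fun ζ hζ => le_trans (mha (hX0G ζ hζ)) (hah _)
  have hγG : ∀ ζ, ζ ⊆ Q → γ₀ ≤ k (G ζ) := fun ζ hζ => le_trans (mka (hX0G ζ hζ)) (kak _)
  have hmemTgt : ∀ ζ, ζ ∈ Tgt ↔ ζ ⊆ Q ∧ ζ ≠ ∅ ∧ ζ ≠ Q := by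
    intro ζ
    simp only [hTgt, Finset.mem_erase, Finset.mem_powerset]
    tauto
  have hf₁nn : ∀ ζ ∈ Tgt, 0 ≤ f₁ ζ := by
    intro ζ hζ
    have hζQ := ((hmemTgt ζ).mp hζ).1
    simp only [hf₁]
    nlinarith [mul_nonneg hα (sub_nonneg.mpr (hγG ζ hζQ)), mul_nonneg hγ (sub_nonneg.mpr (hαG ζ hζQ))]
  have hf₂nn : ∀ ζ ∈ Tgt, 0 ≤ f₂ ζ := by
    intro ζ hζ
    have hζQ := ((hmemTgt ζ).mp hζ).1
    simp only [hf₂]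
    exact mul_nonneg (sub_nonneg.mpr (hαG ζ hζQ)) (sub_nonneg.mpr (hγG ζ hζQ))
  have hmemD : ∀ η, η ∈ D ↔ η ∈ F ∧ η ≠ Q := by
    intro η; simp only [hD, Finset.mem_erase]; tauto
  -- (1) pointwise regime split
  have hpt : ∀ η ∈ D, -(f₁ (Q \ η) + (if X η ≠ X₀ then f₂ (σ η) else 0))
      ≤ (ha (X η) - hb (Y η)) * (ka (X η) - kb (Y η)) := by
    intro η hη
    obtain ⟨hηF, hηQ⟩ := (hmemD η).mp hη
    have hcQ : Q \ η ⊆ Q := Finset.sdiff_subset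
    have hpHc : hb (Y η) ≤ h (G (Q \ η)) := le_trans (hbh _) (hh (hYc η hηF))
    have hqKc : kb (Y η) ≤ k (G (Q \ η)) := le_trans (kbk _) (hk (hYc η hηF))
    by_cases hx : X η ≠ X₀
    · rw [if_pos hx]
      obtain ⟨hsQ, _, _⟩ := hσQ η hηF hηQ hx
      have haHs : ha (X η) ≤ h (G (σ η)) := le_trans (mha (hσX η hηF hηQ hx)) (hah _)
      have hpHs : hb (Y η) ≤ h (G (σ η)) := le_trans (mhb (hσY η hηF hηQ hx)) (hbh _)
      have hcKs : ka (X η) ≤ k (G (σ η)) := le_trans (mka (hσX η hηF hηQ hx)) (kak _)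
      have hqKs : kb (Y η) ≤ k (G (σ η)) := le_trans (mkb (hσY η hηF hηQ hx)) (kbk _)
      have key := fibre_pointwise (α₀ := α₀) (γ₀ := γ₀) (a := ha (X η)) (p := hb (Y η)) (c := ka (X η)) (q := kb (Y η))
        (Hc := h (G (Q \ η))) (Kc := k (G (Q \ η))) (Hs := h (G (σ η))) (Ks := k (G (σ η)))
        hα hγ (mha (hX0X η hηF)) haHs (hb0 _) hpHc hpHs (hαG _ hcQ) (mka (hX0X η hηF)) hcKs (kb0 _) hqKc hqKs (hγG _ hcQ)
      simp only [hf₁, hf₂] at key ⊢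
      linarith
    · rw [if_neg hx, add_zero]
      have hx' : X η = X₀ := not_not.mp hx
      have key := fibre_pointwise_base (α₀ := α₀) (γ₀ := γ₀) (p := hb (Y η)) (q := kb (Y η)) (Hc := h (G (Q \ η))) (Kc := k (G (Q \ η)))
        hα hγ (hb0 _) hpHc (hαG _ hcQ) (kb0 _) hqKc (hγG _ hcQ)
      rw [hx']
      simp only [hf₁] at key ⊢
      linarith
  -- (2) sum of the pointwise bounds
  have hsum : -(∑ η ∈ D, f₁ (Q \ η)) - (∑ η ∈ D', f₂ (σ η)) ≤ ∑ η ∈ D, (ha (X η) - hb (Y η)) * (ka (X η) - kb (Y η)) := by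
    have e1 : ∑ η ∈ D', f₂ (σ η) = ∑ η ∈ D, (if X η ≠ X₀ then f₂ (σ η) else 0) := by
      rw [hD', Finset.sum_filter]
    rw [e1]
    have := Finset.sum_le_sum hpt
    rw [Finset.sum_neg_distrib, Finset.sum_add_distrib] at this
    linarith
  -- (3) the complement partners: injective reindexing into Tgt
  have hc1 : ∑ η ∈ D, f₁ (Q \ η) ≤ ∑ ζ ∈ Tgt, f₁ ζ := by
    refine fibre_sum_le_sum_of_injOn (fun η => Q \ η) ?_ ?_ f₁ hf₁nn
    · intro η₁ hη₁ η₂ hη₂ heq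
      have h1 := hFQ η₁ ((hmemD η₁).mp hη₁).1
      have h2 := hFQ η₂ ((hmemD η₂).mp hη₂).1
      have : Q \ (Q \ η₁) = Q \ (Q \ η₂) := by simp only at heq; rw [heq]
      rwa [Finset.sdiff_sdiff_eq_self h1, Finset.sdiff_sdiff_eq_self h2] at this
    · intro η hη
      obtain ⟨hηF, hηQ⟩ := (hmemD η).mp hη
      have hsub := hFQ η hηF
      refine (hmemTgt _).mpr ⟨Finset.sdiff_subset, ?_, ?_⟩
      · intro h0
        apply hηQ
        exact Finset.Subset.antisymm hsub (Finset.sdiff_eq_empty_iff_subset.mp h0)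
      · intro hQ
        have hdis : Disjoint Q η := Finset.sdiff_eq_self_iff_disjoint.mp hQ
        have : η = ∅ := Finset.eq_empty_of_forall_notMem fun i hi => (Finset.disjoint_left.mp hdis) (hsub hi) hi
        exact hF0 (this ▸ hηF)
  -- (4) the covering partners: injective reindexing into Tgt
  have hc2 : ∑ η ∈ D', f₂ (σ η) ≤ ∑ ζ ∈ Tgt, f₂ ζ := by
    have hmemD' : ∀ η, η ∈ D' ↔ (η ∈ F ∧ η ≠ Q) ∧ X η ≠ X₀ := by
      intro η; simp only [hD', Finset.mem_filter, hmemD]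
    refine fibre_sum_le_sum_of_injOn σ ?_ ?_ f₂ hf₂nn
    · intro η₁ hη₁ η₂ hη₂ heq
      obtain ⟨⟨h1F, h1Q⟩, h1x⟩ := (hmemD' η₁).mp hη₁
      obtain ⟨⟨h2F, h2Q⟩, h2x⟩ := (hmemD' η₂).mp hη₂
      exact hσinj η₁ h1F η₂ h2F h1Q h1x h2Q h2x heq
    · intro η hη
      obtain ⟨⟨hF', hQ'⟩, hx⟩ := (hmemD' η).mp hη
      obtain ⟨hsQ, hs0, hsQ'⟩ := hσQ η hF' hQ' hx
      exact (hmemTgt _).mpr ⟨hsQ, hs0, hsQ'⟩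
  -- (5) the supply splits into the budgets
  have hsup : ∑ ζ ∈ Tgt, (f₁ ζ + f₂ ζ) ≤ ∑ ζ ∈ Tgt, h (G ζ) * k (G ζ) := by
    refine Finset.sum_le_sum fun ζ _ => ?_
    simp only [hf₁, hf₂]
    nlinarith [mul_nonneg hα hγ]
  rw [Finset.sum_add_distrib] at hsup
  linarith [hsum, hc1, hc2, hsup]

end Coefficientwise

end Summit.CriticalPhenomena.PercolationContinuityZ3.Theorems
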